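import Literature.AlgebraicGeometry.ShimuraVarieties.UnitaryBallDiscontinuity
import HarnessLib

/-!
# Special sub-balls of an arithmetic ball quotient: local finiteness (Kudla–Millson Lemma 1.1)

Topic `AlgebraicGeometry/ShimuraVarieties`; namespace
`Literature.AlgebraicGeometry.ShimuraVarieties` (datum API dotted on `UnitaryBallUniformisationDatum`).

Let `D : UnitaryBallUniformisationDatum 2 X` be a unitary ball-quotient datum (CM field `E ⊆ ℂ`,
hermitian `H ∈ M₃(E)` of signature `(2,1)` at `τ₁` and definite at the other places, torsion-free
congruence subgroup `Γ ≤ U(H)(E)`, uniformisation `Γ\𝔹² ≅ X(ℂ)`), and `𝔣` a Sylvester frame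
(`UnitaryBallRealPoints`), so that `Γ` acts on the affine ball `𝔹² ⊆ ℂ²` through
`D.ballRep 𝔣 : Γ →* U(2,1)`. For a set of vectors `S ⊆ V = E³` the **special sub-ball**
`D.specialBall 𝔣 S ⊆ 𝔹²` is the set of ball points whose lift `T (z, 1)` to the negative cone is
`H`-orthogonal to `τ₁(S)` — the sub-ball `𝔹(W^⊥)` of Kudla–Millson / Bergeron–Millson–Moeglin for
`W = span S` (BMM Part 2 §3.3: "the totally geodesic submanifold `D_W ⊆ D` of negative lines
orthogonal to `W`"). Its `Γ`-translates are the special sub-balls of the translated subspaces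
(`smul_mem_specialBall_iff`: `γ · 𝔹(S^⊥) = 𝔹((γS)^⊥)`).

MAIN RESULT (the arithmetic core of Kudla–Millson, Publ. Math. IHÉS 71 (1990), Lemma 1.1, p. 128:
"Suppose `Γ` is arithmetic and `G₁` is defined over `ℚ`. Then `j₁` is a proper embedding"):

* `finite_vact_meeting` — for `w ∈ E³` and a compact `K ⊆ 𝔹²`, only FINITELY MANY vectors `γ w`
  (`γ ∈ Γ`) have their special sub-ball `𝔹((γw)^⊥)` meeting `K`;
* `finite_translates_specialBall` — hence for a finite `S ⊆ E³` only finitely many translates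
  `γ S` have `𝔹((γS)^⊥) ∩ K ≠ ∅`: the family of `Γ`-translates of a special sub-ball is locally
  finite (the input for "the image of `D_W` in `Γ\D` is closed", `UnitaryBallSpecialCycleClosed`).

PROOF (elementary, after Borel, *Introduction aux groupes arithmétiques* §1 / §8 — an arithmetic
group preserves a lattice, and lattice vectors with all conjugates bounded are finite in number):
if `s = γ w` is orthogonal to the lift `T(z,1)` of `z ∈ K`, `|z|² ≤ 1 - ε`, then in frame
coordinates `y = T⁻¹ τ₁(s)` one has `ȳ₂ = ȳ₀ z₀ + ȳ₁ z₁`, so Cauchy–Schwarz gives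
`|y₂|² ≤ (|y₀|² + |y₁|²)(1 - ε)` and `Q(y) = ⟪s,s⟫ = ⟪w,w⟫` forces `|yᵢ|² ≤ ⟪w,w⟫/ε`
(`norm_sq_frame_le`); at the definite places `τ` the vector `τ(s)` lies on the compact sphere
`⟪x,x⟫_τ = τ⟪w,w⟫`; and `d · s` is integral for one `d ≥ 1` depending on `w` only (coset
representatives of `Γ(𝔫)` in `Γ`, `exists_int_isIntegral_vact`). So the entries of `d · s` range in
the finite set of algebraic integers with all conjugates bounded
(`NumberField.Embeddings.finite_of_norm_le`).

References: S. Kudla, J. Millson, Publ. Math. IHÉS 71 (1990), Lemma 1.1 p. 128; N. Bergeron,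
J. Millson, C. Moeglin, Acta Math. 216 (2016), Introduction §1.7, Part 2 §§3.2–3.3; A. Borel,
*Introduction aux groupes arithmétiques* (1969), §1, Prop. 7.13.

## Provenance

Written for the pub-hodgecm2 (COR-CM) cell, lane SPECIAL-CYCLES (seat b06): first of the files
proving the record `Literature.NumberTheory.Automorphic.PicardCM.SpecialCyclesAlgebraic`
(Kudla–Millson Lemma 1.1 + Chow). Nothing in this file is a claim of the manuscripts adjudicated
by that cell.
-/

set_option autoImplicit false

noncomputable section

open Matrix Complex ComplexConjugate NumberField
open Literature.Geometry.ComplexHyperbolic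
open Literature.Geometry.ComplexHyperbolic.BallModel
open scoped ComplexOrder

namespace Literature.AlgebraicGeometry.ShimuraVarieties

/-! ### Three elementary estimates -/

section Helpers

/-- Entry bound for a `3 × 3` matrix applied to a vector: `‖(M y)ᵢ‖ ≤ 3 R S` if `‖Mᵢⱼ‖ ≤ R` and
`‖yⱼ‖ ≤ S`. [folklore] -/
private theorem norm_mulVec_apply_le {M : Matrix (Fin 3) (Fin 3) ℂ} {y : Fin 3 → ℂ} {R S : ℝ}
    (hM : ∀ i j, ‖M i j‖ ≤ R) (hy : ∀ j, ‖y j‖ ≤ S) (i : Fin 3) : ‖(M *ᵥ y) i‖ ≤ 3 * (R * S) := by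
  rw [Matrix.mulVec, dotProduct]
  calc ‖∑ j, M i j * y j‖ ≤ ∑ j, ‖M i j * y j‖ := norm_sum_le _ _
    _ ≤ ∑ _j : Fin 3, R * S := Finset.sum_le_sum fun j _ ↦ by
        rw [norm_mul]
        exact mul_le_mul (hM i j) (hy j) (norm_nonneg _) ((norm_nonneg _).trans (hM i j))
    _ = 3 * (R * S) := by simp

/-- **Coercivity of a positive definite hermitian form**: `m ‖x‖² ≤ Re(xᴴ H x)` for some `m > 0`
(minimum of the form on the unit sphere). [cite: Knapp2002, I.§1] -/
theorem exists_pos_mul_norm_sq_le_of_posDef {n : Type*} [Fintype n]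
    {H : Matrix n n ℂ} (hH : H.PosDef) :
    ∃ m : ℝ, 0 < m ∧ ∀ x : n → ℂ, m * ‖x‖ ^ 2 ≤ (star x ⬝ᵥ (H *ᵥ x)).re := by
  classical
  rcases isEmpty_or_nonempty n with hn | ⟨⟨i₀⟩⟩
  · refine ⟨1, one_pos, fun x ↦ ?_⟩
    have hx : x = 0 := Subsingleton.elim _ _
    subst hx
    simp
  set q : (n → ℂ) → ℝ := fun x ↦ (star x ⬝ᵥ (H *ᵥ x)).re with hq
  have hq_cont : Continuous q :=
    Complex.continuous_re.comp
      ((continuous_star).dotProduct (continuous_const.matrix_mulVec continuous_id))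
  set S : Set (n → ℂ) := Metric.sphere 0 1 with hS
  have hScpt : IsCompact S := isCompact_sphere 0 1
  have hSne : S.Nonempty := ⟨Pi.single i₀ 1, by simp [hS, Pi.norm_single]⟩
  obtain ⟨x₀, hx₀S, hmin⟩ := hScpt.exists_isMinOn hSne hq_cont.continuousOn
  have hx₀ : x₀ ≠ 0 := by
    intro h
    rw [h, hS, Metric.mem_sphere, dist_zero_right, norm_zero] at hx₀S
    exact zero_ne_one hx₀S
  have hm_pos : 0 < q x₀ := by
    have := hH.re_dotProduct_pos hx₀
    simpa [hq] using this
  refine ⟨q x₀, hm_pos, fun x ↦ ?_⟩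
  by_cases hx : x = 0
  · subst hx
    simp [hq]
  have hxn : 0 < ‖x‖ := norm_pos_iff.mpr hx
  set u : n → ℂ := ((‖x‖⁻¹ : ℝ) : ℂ) • x with hu
  have huS : u ∈ S := by
    rw [hS, Metric.mem_sphere, dist_zero_right, hu, norm_smul, Complex.norm_real, Real.norm_eq_abs,
      abs_inv, abs_norm, inv_mul_cancel₀ hxn.ne']
  have h1 : q x₀ ≤ q u := hmin huS
  have h2 : q u = ‖x‖⁻¹ ^ 2 * q x := by
    have := Literature.NumberTheory.Automorphic.Matrix.re_star_dotProduct_mulVec_real_smul H ‖x‖⁻¹ x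
    simpa [hq, hu] using this
  rw [h2] at h1
  calc q x₀ * ‖x‖ ^ 2 ≤ ‖x‖⁻¹ ^ 2 * q x * ‖x‖ ^ 2 :=
        mul_le_mul_of_nonneg_right h1 (sq_nonneg _)
    _ = q x := by field_simp

/-- `xᴴ (Aᴴ u) = (A x)ᴴ u`. [folklore] -/
private theorem star_dotProduct_conjTranspose_mulVec {m : Type*} [Fintype m] (A : Matrix m m ℂ)
    (x u : m → ℂ) : star x ⬝ᵥ (Aᴴ *ᵥ u) = star (A *ᵥ x) ⬝ᵥ u := by
  rw [star_mulVec, dotProduct_mulVec]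

/-- The Cauchy–Schwarz inequality for two terms, squared form. [folklore] -/
private theorem sq_add_mul_le (a b c d : ℝ) : (a * c + b * d) ^ 2 ≤ (a ^ 2 + b ^ 2) * (c ^ 2 + d ^ 2) := by
  nlinarith [sq_nonneg (a * d - b * c)]

end Helpers

namespace UnitaryBallUniformisationDatum

open Literature.AlgebraicGeometry.Motives (SchemeOver)

/-! ### `Γ` acting on `V = E^{p+1}`; the pairing with cone vectors (any `p`) -/

section General

variable {p : ℕ} {X : SchemeOver ℂ} (D : UnitaryBallUniformisationDatum p X)

/-- The action of `γ ∈ Γ ≤ GL_{p+1}(E)` on `V = E^{p+1}`: `γ · w`.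
[cite: BergeronMillsonMoeglin2016Balls, Part 2 §1.2] -/
def vact (γ : D.Γ) (w : Fin (p + 1) → D.E) : Fin (p + 1) → D.E :=
  ((γ : GL (Fin (p + 1)) D.E) : Matrix (Fin (p + 1)) (Fin (p + 1)) D.E) *ᵥ w

/-- `1 · w = w` (the action of `U(V)(F) ≤ GL(V)` on `V`). [cite: BergeronMillsonMoeglin2016Balls, Part 2 §1.2] -/
@[simp] theorem vact_one (w : Fin (p + 1) → D.E) : D.vact 1 w = w := by
  simp [vact]

/-- `(γγ') · w = γ · (γ' · w)`. [cite: BergeronMillsonMoeglin2016Balls, Part 2 §1.2] -/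
theorem vact_mul (γ γ' : D.Γ) (w : Fin (p + 1) → D.E) :
    D.vact (γ * γ') w = D.vact γ (D.vact γ' w) := by
  simp [vact, mulVec_mulVec]

/-- `γ⁻¹ · (γ · w) = w`. [cite: BergeronMillsonMoeglin2016Balls, Part 2 §1.2] -/
@[simp] theorem vact_inv_vact (γ : D.Γ) (w : Fin (p + 1) → D.E) : D.vact γ⁻¹ (D.vact γ w) = w := by
  rw [← vact_mul, inv_mul_cancel, vact_one]

/-- `γ · (γ⁻¹ · w) = w`. [cite: BergeronMillsonMoeglin2016Balls, Part 2 §1.2] -/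
@[simp] theorem vact_vact_inv (γ : D.Γ) (w : Fin (p + 1) → D.E) : D.vact γ (D.vact γ⁻¹ w) = w := by
  rw [← vact_mul, mul_inv_cancel, vact_one]

/-- The action on `V` is additive: `γ · (w + w') = γ · w + γ · w'` (`U(V)(F)` acts `E`-linearly).
[cite: BergeronMillsonMoeglin2016Balls, Part 2 §1.2] -/
theorem vact_add (γ : D.Γ) (w w' : Fin (p + 1) → D.E) :
    D.vact γ (w + w') = D.vact γ w + D.vact γ w' := by
  simp [vact, mulVec_add]

/-- `γ · (a w) = a (γ · w)`. [cite: BergeronMillsonMoeglin2016Balls, Part 2 §1.2] -/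
theorem vact_smul (γ : D.Γ) (a : D.E) (w : Fin (p + 1) → D.E) :
    D.vact γ (a • w) = a • D.vact γ w := by
  simp [vact, mulVec_smul]

/-- At a complex embedding `τ`: `τ(γ · w) = γ^τ · τ(w)` (the completion `V_τ = V ⊗_{E,τ} ℂ`).
[cite: BergeronMillsonMoeglin2016Balls, Part 2 §1.1] -/
theorem embedding_comp_vact (τ : D.E →+* ℂ) (γ : D.Γ) (w : Fin (p + 1) → D.E) :
    τ ∘ D.vact γ w =
      ((γ : GL (Fin (p + 1)) D.E) : Matrix (Fin (p + 1)) (Fin (p + 1)) D.E).map τ *ᵥ (τ ∘ w) := by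
  funext i
  exact RingHom.map_mulVec τ _ w i

/-- **Isometry at every place**: `Re ⟪τ(γw), τ(γw)⟫_τ = Re ⟪τ w, τ w⟫_τ` for `γ ∈ Γ ≤ U(H)`.
[cite: BergeronMillsonMoeglin2016Balls, Part 2 §1.2] -/
theorem re_form_embedding_vact (τ : D.E →+* ℂ) (γ : D.Γ) (w : Fin (p + 1) → D.E) :
    (star (τ ∘ D.vact γ w) ⬝ᵥ (D.H.map τ *ᵥ (τ ∘ D.vact γ w))).re =
      (star (τ ∘ w) ⬝ᵥ (D.H.map τ *ᵥ (τ ∘ w))).re := by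
  rw [embedding_comp_vact]
  have h := Literature.NumberTheory.Automorphic.Matrix.re_star_dotProduct_mulVec_mulVec
    (D.conjTranspose_map_mul_map τ (D.isCongruenceSubgroup.1 γ.2)) (τ ∘ w)
  simpa using h

/-- The **pairing** of a rational vector `s ∈ V` with a complex vector `v ∈ V_{τ₁} = ℂ^{p+1}`:
`⟪τ₁ s, v⟫ = (τ₁ s)ᴴ H^{τ₁} v`. [cite: BergeronMillsonMoeglin2016Balls, Part 2 §1.1] -/
def pairE (s : Fin (p + 1) → D.E) (v : Fin (p + 1) → ℂ) : ℂ :=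
  hermForm (starRingEnd ℂ) D.Hℂ (D.τ₁ ∘ s) v

/-- Unfolding of the pairing: `⟪τ₁ s, v⟫ = (τ₁ s)ᴴ H^{τ₁} v`. [cite: BergeronMillsonMoeglin2016Balls, Part 2 §1.1] -/
theorem pairE_eq (s : Fin (p + 1) → D.E) (v : Fin (p + 1) → ℂ) :
    D.pairE s v = star (D.τ₁ ∘ s) ⬝ᵥ (D.Hℂ *ᵥ v) := rfl

/-- The pairing is additive in the rational vector. [cite: BergeronMillsonMoeglin2016Balls, Part 2 §1.1] -/
theorem pairE_add (s s' : Fin (p + 1) → D.E) (v : Fin (p + 1) → ℂ) :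
    D.pairE (s + s') v = D.pairE s v + D.pairE s' v := by
  simp only [pairE_eq]
  have : D.τ₁ ∘ (s + s') = D.τ₁ ∘ s + D.τ₁ ∘ s' := by funext i; simp
  rw [this, star_add, add_dotProduct]

/-- The pairing is conjugate-linear in the rational vector (the form is sesquilinear).
[cite: BergeronMillsonMoeglin2016Balls, Part 2 §1.1] -/
theorem pairE_smul (a : D.E) (s : Fin (p + 1) → D.E) (v : Fin (p + 1) → ℂ) :
    D.pairE (a • s) v = starRingEnd ℂ (D.τ₁ a) * D.pairE s v := by
  simp only [pairE_eq]
  have : D.τ₁ ∘ (a • s) = D.τ₁ a • (D.τ₁ ∘ s) := by funext i; simp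
  rw [this, star_smul, smul_dotProduct, smul_eq_mul, Complex.star_def]

/-- The pairing is `ℂ`-linear in the complex vector: `⟪s, c v⟫ = c ⟪s, v⟫`.
[cite: BergeronMillsonMoeglin2016Balls, Part 2 §1.1] -/
theorem pairE_smul_right (s : Fin (p + 1) → D.E) (c : ℂ) (v : Fin (p + 1) → ℂ) :
    D.pairE s (c • v) = c * D.pairE s v := by
  rw [pairE_eq, pairE_eq, mulVec_smul, dotProduct_smul, smul_eq_mul]

/-- The zero vector pairs to zero. [cite: BergeronMillsonMoeglin2016Balls, Part 2 §1.1] -/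
@[simp] theorem pairE_zero_left (v : Fin (p + 1) → ℂ) : D.pairE 0 v = 0 := by
  simp [pairE_eq]

/-- **Invariance of the pairing**: `⟪γ s, γ v⟫ = ⟪s, v⟫` for `γ ∈ Γ` (`(γ^{τ₁})ᴴ H^{τ₁} γ^{τ₁} = H^{τ₁}`).
[cite: BergeronMillsonMoeglin2016Balls, Part 2 §1.2] -/
theorem pairE_vact_act (γ : D.Γ) (s : Fin (p + 1) → D.E) (v : Fin (p + 1) → ℂ) :
    D.pairE (D.vact γ s) (D.act γ v) = D.pairE s v := by
  rw [pairE_eq, pairE_eq, embedding_comp_vact, act, star_mulVec, mulVec_mulVec, dotProduct_mulVec,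
    vecMul_vecMul, ← Matrix.mul_assoc, D.conjTranspose_mul_Hℂ_mul (D.isCongruenceSubgroup.1 γ.2),
    ← dotProduct_mulVec]

/-- **One denominator for a whole orbit**: for `w ∈ V` there is an integer `d ≠ 0` with `d · (γ w)ᵢ`
an algebraic integer for every `γ ∈ Γ` and every `i` (write `γ = s δ` with `s` one of finitely many
coset representatives of the principal congruence subgroup `Γ(𝔫)` and `δ ∈ Γ(𝔫)` integral; clear
the denominators of the entries of the `s` and of `w`). [cite: Borel1969, §1] -/
theorem exists_int_isIntegral_vact (w : Fin (p + 1) → D.E) :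
    ∃ d : ℤ, d ≠ 0 ∧ ∀ γ : D.Γ, ∀ i, IsIntegral ℤ (d • D.vact γ w i) := by
  classical
  obtain ⟨n, -, hle, hfi⟩ := D.isCongruenceSubgroup.2
  set N : Subgroup D.Γ := (principalCongruenceSubgroup (conjRingHom D.E) D.H n).subgroupOf D.Γ
  haveI : N.FiniteIndex := hfi
  haveI : Fintype (D.Γ ⧸ N) := Fintype.ofFinite _
  let rep : D.Γ ⧸ N → D.Γ := fun q ↦ q.out
  -- the finite set of field elements whose denominators must be cleared
  let T : Finset D.E :=
    (Finset.univ.biUnion fun q : D.Γ ⧸ N ↦ Finset.univ.image fun ij : Fin (p + 1) × Fin (p + 1) ↦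
      ((rep q : GL (Fin (p + 1)) D.E) : Matrix (Fin (p + 1)) (Fin (p + 1)) D.E) ij.1 ij.2) ∪
    Finset.univ.image w
  obtain ⟨y, hy, hT⟩ := exists_integral_multiples ℤ ℚ T
  have hrep : ∀ q i j, IsIntegral ℤ
      (y • ((rep q : GL (Fin (p + 1)) D.E) : Matrix (Fin (p + 1)) (Fin (p + 1)) D.E) i j) :=
    fun q i j ↦ hT _ (Finset.mem_union_left _
      (Finset.mem_biUnion.2 ⟨q, Finset.mem_univ _, Finset.mem_image.2 ⟨(i, j), Finset.mem_univ _, rfl⟩⟩))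
  have hw : ∀ k, IsIntegral ℤ (y • w k) :=
    fun k ↦ hT _ (Finset.mem_union_right _ (Finset.mem_image.2 ⟨k, Finset.mem_univ _, rfl⟩))
  refine ⟨y * y, mul_ne_zero hy hy, fun γ i ↦ ?_⟩
  -- `γ = rep q * δ` with `δ ∈ Γ(𝔫)` integral
  set q : D.Γ ⧸ N := (γ : D.Γ ⧸ N)
  set δ : D.Γ := (rep q)⁻¹ * γ with hδ
  have hδN : δ ∈ N := by
    rw [hδ, ← QuotientGroup.eq]
    exact QuotientGroup.out_eq' _
  have hδP : (δ : GL (Fin (p + 1)) D.E) ∈ principalCongruenceSubgroup (conjRingHom D.E) D.H n :=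
    Subgroup.mem_subgroupOf.1 hδN
  have hγ : γ = rep q * δ := by rw [hδ, mul_inv_cancel_left]
  have hδint : ∀ j k, IsIntegral ℤ
      (((δ : GL (Fin (p + 1)) D.E) : Matrix (Fin (p + 1)) (Fin (p + 1)) D.E) j k) :=
    fun j k ↦ D.isIntegral_apply hδP j k
  -- the entry as a double sum
  have hentry : (y * y) • D.vact γ w i =
      ∑ j, (y • ((rep q : GL (Fin (p + 1)) D.E) : Matrix (Fin (p + 1)) (Fin (p + 1)) D.E) i j) *
        ∑ k, ((δ : GL (Fin (p + 1)) D.E) : Matrix (Fin (p + 1)) (Fin (p + 1)) D.E) j k *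
          (y • w k) := by
    rw [hγ, vact_mul]
    simp only [vact, mulVec, dotProduct, Finset.smul_sum, Finset.mul_sum, zsmul_eq_mul,
      Int.cast_mul]
    refine Finset.sum_congr rfl fun j _ ↦ Finset.sum_congr rfl fun k _ ↦ ?_
    ring
  rw [hentry]
  refine IsIntegral.sum _ fun j _ ↦ (hrep q i j).mul (IsIntegral.sum _ fun k _ ↦ ?_)
  exact (hδint j k).mul (hw k)

end General

/-! ### Special sub-balls (`p = 2`) -/

variable {X₂ : SchemeOver ℂ} (D : UnitaryBallUniformisationDatum 2 X₂) (𝔣 : D.SylvesterFrame)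

/-- The **special sub-ball** `𝔹(S^⊥) ⊆ 𝔹²` of a set `S ⊆ V = E³` in the frame `𝔣`: the ball points
`z` whose lift `T(z,1)` to the negative cone is `H`-orthogonal to every `τ₁(s)`, `s ∈ S` (for
`S` spanning a totally positive subspace `W` this is the sub-ball `D_W` of negative lines orthogonal
to `W`, uniformising the special cycle of `W`; empty or all of `𝔹²` for degenerate `S`).
[cite: BergeronMillsonMoeglin2016Balls, Part 2 §3.3] -/
def specialBall (S : Set (Fin 3 → D.E)) : Set Ball :=
  {z | ∀ s ∈ S, D.pairE s (D.coneLift 𝔣 z : Fin 3 → ℂ) = 0}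

/-- Membership in a special sub-ball: the lift is orthogonal to `τ₁(S)`.
[cite: BergeronMillsonMoeglin2016Balls, Part 2 §3.3] -/
theorem mem_specialBall_iff {S : Set (Fin 3 → D.E)} {z : Ball} :
    z ∈ D.specialBall 𝔣 S ↔ ∀ s ∈ S, D.pairE s (D.coneLift 𝔣 z : Fin 3 → ℂ) = 0 :=
  Iff.rfl

/-- Special sub-balls are antitone in `S` (`S ⊆ S' ⇒ 𝔹(S'^⊥) ⊆ 𝔹(S^⊥)`).
[cite: BergeronMillsonMoeglin2016Balls, Part 2 §3.3] -/
theorem specialBall_mono {S S' : Set (Fin 3 → D.E)} (h : S ⊆ S') :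
    D.specialBall 𝔣 S' ⊆ D.specialBall 𝔣 S :=
  fun _ hz s hs ↦ hz s (h hs)

/-- The special sub-ball of the empty set is the whole ball (`W = 0`: `D_W = D`).
[cite: BergeronMillsonMoeglin2016Balls, Part 2 §3.3] -/
@[simp] theorem specialBall_empty : D.specialBall 𝔣 ∅ = Set.univ :=
  Set.eq_univ_of_forall fun _ _ hs ↦ hs.elim

/-- The special sub-ball of a union is the intersection of the special sub-balls.
[cite: BergeronMillsonMoeglin2016Balls, Part 2 §3.3] -/
theorem specialBall_union (S S' : Set (Fin 3 → D.E)) :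
    D.specialBall 𝔣 (S ∪ S') = D.specialBall 𝔣 S ∩ D.specialBall 𝔣 S' := by
  ext z
  simp only [mem_specialBall_iff, Set.mem_union, Set.mem_inter_iff]
  exact ⟨fun h ↦ ⟨fun s hs ↦ h s (Or.inl hs), fun s hs ↦ h s (Or.inr hs)⟩,
    fun h s hs ↦ hs.elim (h.1 s) (h.2 s)⟩

/-- The special sub-ball of a single vector is cut out by one equation `⟪τ₁ s, T(z,1)⟫ = 0`.
[cite: BergeronMillsonMoeglin2016Balls, Part 2 §3.3] -/
theorem specialBall_singleton (s : Fin 3 → D.E) :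
    D.specialBall 𝔣 {s} = {z | D.pairE s (D.coneLift 𝔣 z : Fin 3 → ℂ) = 0} := by
  ext z; simp [mem_specialBall_iff]

/-- A special sub-ball depends only on the `E`-span of `S`: orthogonality to `S` is orthogonality
to `span S` (the pairing is conjugate-linear in the rational vector).
[cite: BergeronMillsonMoeglin2016Balls, Part 2 §3.3] -/
theorem specialBall_span (S : Set (Fin 3 → D.E)) :
    D.specialBall 𝔣 (Submodule.span D.E S : Set (Fin 3 → D.E)) = D.specialBall 𝔣 S := by
  refine Set.Subset.antisymm (D.specialBall_mono 𝔣 Submodule.subset_span) fun z hz s hs ↦ ?_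
  induction hs using Submodule.span_induction with
  | mem s hs => exact hz s hs
  | zero => simp
  | add s t _ _ hs ht => rw [pairE_add, hs, ht, add_zero]
  | smul a s _ hs => rw [pairE_smul, hs, mul_zero]

/-- The pairing with a lifted ball point is continuous in the ball point (so `D_W` is closed in `D`).
[cite: BergeronMillsonMoeglin2016Balls, Part 2 §3.3] -/
theorem continuous_pairE_coneLift (s : Fin 3 → D.E) :
    Continuous fun z : Ball ↦ D.pairE s (D.coneLift 𝔣 z : Fin 3 → ℂ) := by
  simp only [pairE_eq]
  exact continuous_const.dotProduct
    (continuous_const.matrix_mulVec (continuous_subtype_val.comp (D.continuous_coneLift 𝔣)))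

/-- Special sub-balls are closed in `𝔹²`. [cite: KudlaMillson1990, Lemma 1.1, p. 128] -/
theorem isClosed_specialBall (S : Set (Fin 3 → D.E)) : IsClosed (D.specialBall 𝔣 S) := by
  have : D.specialBall 𝔣 S = ⋂ s ∈ S, {z | D.pairE s (D.coneLift 𝔣 z : Fin 3 → ℂ) = 0} := by
    ext z; simp [mem_specialBall_iff]
  rw [this]
  exact isClosed_biInter fun s _ ↦ isClosed_eq (D.continuous_pairE_coneLift 𝔣 s) continuous_const

/-! ### Equivariance: `γ · 𝔹(S^⊥) = 𝔹((γS)^⊥)` -/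

/-- The lift of `ballRep γ • z` is proportional to `γ^{τ₁}` applied to the lift of `z`.
[cite: BergeronMillsonMoeglin2016Balls, Part 2 §1.3] -/
theorem exists_act_coneLift_eq_smul (γ : D.Γ) (z : Ball) :
    ∃ c : ℂ, c ≠ 0 ∧ D.act γ (D.coneLift 𝔣 z : Fin 3 → ℂ) =
      c • (D.coneLift 𝔣 (D.ballRep 𝔣 γ • z) : Fin 3 → ℂ) := by
  have h : D.coneChart 𝔣 (D.toRealPoints γ • D.coneLift 𝔣 z) =
      D.coneChart 𝔣 (D.coneLift 𝔣 (D.ballRep 𝔣 γ • z)) := by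
    rw [coneChart_act, coneChart_coneLift, coneChart_coneLift]
  obtain ⟨c, hc, hcv⟩ := (D.coneChart_eq_iff 𝔣 _ _).1 h
  exact ⟨c, hc, by rw [← coe_toRealPoints_smul]; exact hcv⟩

/-- **Equivariance of special sub-balls**: `γ z ∈ 𝔹((γS)^⊥) ↔ z ∈ 𝔹(S^⊥)`, i.e.
`γ · 𝔹(S^⊥) = 𝔹((γ S)^⊥)`. [cite: BergeronMillsonMoeglin2016Balls, Part 2 §3.3] -/
theorem smul_mem_specialBall_iff (γ : D.Γ) (S : Set (Fin 3 → D.E)) (z : Ball) :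
    D.ballRep 𝔣 γ • z ∈ D.specialBall 𝔣 (D.vact γ '' S) ↔ z ∈ D.specialBall 𝔣 S := by
  obtain ⟨c, hc, hcv⟩ := D.exists_act_coneLift_eq_smul 𝔣 γ z
  simp only [mem_specialBall_iff, Set.forall_mem_image]
  refine forall₂_congr fun s _ ↦ ?_
  have key : D.pairE (D.vact γ s) (D.coneLift 𝔣 (D.ballRep 𝔣 γ • z) : Fin 3 → ℂ) =
      c⁻¹ * D.pairE s (D.coneLift 𝔣 z : Fin 3 → ℂ) := by
    rw [← D.pairE_vact_act γ s, hcv, pairE_smul_right, ← mul_assoc, inv_mul_cancel₀ hc, one_mul]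
  rw [key, mul_eq_zero, or_iff_right (inv_ne_zero hc)]

/-- The translate of a special sub-ball is a special sub-ball: `γ · 𝔹(S^⊥) = 𝔹((γS)^⊥)` as sets.
[cite: BergeronMillsonMoeglin2016Balls, Part 2 §3.3] -/
theorem image_smul_specialBall (γ : D.Γ) (S : Set (Fin 3 → D.E)) :
    (fun z ↦ D.ballRep 𝔣 γ • z) '' D.specialBall 𝔣 S = D.specialBall 𝔣 (D.vact γ '' S) := by
  ext z
  constructor
  · rintro ⟨z', hz', rfl⟩
    exact (D.smul_mem_specialBall_iff 𝔣 γ S z').2 hz'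
  · intro hz
    refine ⟨(D.ballRep 𝔣 γ)⁻¹ • z, ?_, smul_inv_smul _ _⟩
    rw [← D.smul_mem_specialBall_iff 𝔣 γ S, smul_inv_smul]
    exact hz

/-! ### The frame formula for the pairing and the basic estimate -/

/-- **The pairing in frame coordinates**: with `y = T⁻¹ τ₁(s)`,
`⟪τ₁ s, T(z,1)⟫ = yᴴ J (z₀, z₁, 1) = ȳ₀ z₀ + ȳ₁ z₁ - ȳ₂` (the ball of negative lines in the coordinates
`V_{τ₁} ≅ ℂ³` of a Sylvester frame). [cite: BergeronMillsonMoeglin2016Balls, Part 2 §1.3] -/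
theorem pairE_coneLift_eq (s : Fin 3 → D.E) (z : Ball) :
    D.pairE s (D.coneLift 𝔣 z : Fin 3 → ℂ) =
      starRingEnd ℂ ((𝔣.ti *ᵥ (D.τ₁ ∘ s)) 0) * z.1 0 +
        starRingEnd ℂ ((𝔣.ti *ᵥ (D.τ₁ ∘ s)) 1) * z.1 1 -
          starRingEnd ℂ ((𝔣.ti *ᵥ (D.τ₁ ∘ s)) 2) := by
  have hlift : ((D.coneLift 𝔣 z : D.cone) : Fin 3 → ℂ) = 𝔣.t *ᵥ BallModel.lift z := rfl
  rw [pairE_eq, hlift, 𝔣.Hℂ_eq, mulVec_mulVec, Matrix.mul_assoc, Matrix.mul_assoc, 𝔣.ti_mul_t,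
    Matrix.mul_one, ← mulVec_mulVec, star_dotProduct_conjTranspose_mulVec]
  have hJ : BallModel.J *ᵥ BallModel.lift z = ![z.1 0, z.1 1, -1] := by
    ext i
    fin_cases i <;> simp [BallModel.J, BallModel.lift, mulVec_diagonal]
  rw [hJ, dotProduct, Fin.sum_univ_three]
  simp only [Pi.star_apply, Complex.star_def, Matrix.cons_val_zero, Matrix.cons_val_one,
    Matrix.cons_val]
  ring

/-- `Q(T⁻¹ τ₁ s) = Re ⟪s, s⟫` is constant along the orbit: `Q(T⁻¹ τ₁(γ w)) = Q(T⁻¹ τ₁ w)`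
(`Γ ≤ U(V)(F)` acts by isometries). [cite: BergeronMillsonMoeglin2016Balls, Part 2 §1.2] -/
theorem Q_frame_vact (γ : D.Γ) (w : Fin 3 → D.E) :
    Q (𝔣.ti *ᵥ (D.τ₁ ∘ D.vact γ w)) = Q (𝔣.ti *ᵥ (D.τ₁ ∘ w)) := by
  have h1 := 𝔣.Q_ti_mulVec (D.τ₁ ∘ D.vact γ w)
  have h2 := 𝔣.Q_ti_mulVec (D.τ₁ ∘ w)
  have h3 := D.re_form_embedding_vact D.τ₁ γ w
  apply Complex.ofReal_injective
  apply Complex.ext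
  · rw [h1, h2]
    exact h3
  · simp

/-- **The basic estimate.** If `τ₁(s)` is orthogonal to the lift of a ball point `z` with
`|z|² ≤ 1 - ε`, then in frame coordinates `y = T⁻¹ τ₁ s` every `|yᵢ|²` is at most `Q(y)/ε`
(`ȳ₂ = ȳ₀ z₀ + ȳ₁ z₁` and Cauchy–Schwarz give `|y₂|² ≤ (1-ε)(|y₀|²+|y₁|²)`, while
`Q(y) = |y₀|² + |y₁|² - |y₂|²`). [cite: KudlaMillson1990, Lemma 1.1, p. 128] -/
theorem norm_sq_frame_le {s : Fin 3 → D.E} {z : Ball} {ε : ℝ} (hε : 0 < ε)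
    (hz : nsq z.1 ≤ 1 - ε) (horth : D.pairE s (D.coneLift 𝔣 z : Fin 3 → ℂ) = 0) (i : Fin 3) :
    ε * ‖(𝔣.ti *ᵥ (D.τ₁ ∘ s)) i‖ ^ 2 ≤ Q (𝔣.ti *ᵥ (D.τ₁ ∘ s)) := by
  rw [pairE_coneLift_eq, sub_eq_zero] at horth
  set y := 𝔣.ti *ᵥ (D.τ₁ ∘ s) with hy
  -- norms of the relation `ȳ₀ z₀ + ȳ₁ z₁ = ȳ₂`
  have hn2 : ‖y 2‖ ≤ ‖y 0‖ * ‖z.1 0‖ + ‖y 1‖ * ‖z.1 1‖ := by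
    calc ‖y 2‖ = ‖starRingEnd ℂ (y 2)‖ := (Complex.norm_conj _).symm
      _ = ‖starRingEnd ℂ (y 0) * z.1 0 + starRingEnd ℂ (y 1) * z.1 1‖ := by rw [horth]
      _ ≤ ‖starRingEnd ℂ (y 0) * z.1 0‖ + ‖starRingEnd ℂ (y 1) * z.1 1‖ := norm_add_le _ _
      _ = ‖y 0‖ * ‖z.1 0‖ + ‖y 1‖ * ‖z.1 1‖ := by simp only [norm_mul, Complex.norm_conj]
  have hcs : ‖y 2‖ ^ 2 ≤ (‖y 0‖ ^ 2 + ‖y 1‖ ^ 2) * nsq z.1 := by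
    calc ‖y 2‖ ^ 2 ≤ (‖y 0‖ * ‖z.1 0‖ + ‖y 1‖ * ‖z.1 1‖) ^ 2 := by
          gcongr
      _ ≤ (‖y 0‖ ^ 2 + ‖y 1‖ ^ 2) * (‖z.1 0‖ ^ 2 + ‖z.1 1‖ ^ 2) := sq_add_mul_le _ _ _ _
      _ = (‖y 0‖ ^ 2 + ‖y 1‖ ^ 2) * nsq z.1 := by rw [nsq]
  have hQ : Q y = ‖y 0‖ ^ 2 + ‖y 1‖ ^ 2 - ‖y 2‖ ^ 2 := rfl
  have hnsq0 : 0 ≤ nsq z.1 := nsq_nonneg _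
  have h01 : ε * (‖y 0‖ ^ 2 + ‖y 1‖ ^ 2) ≤ Q y := by
    rw [hQ]
    nlinarith [sq_nonneg ‖y 0‖, sq_nonneg ‖y 1‖]
  have hε1 : ε ≤ 1 := by nlinarith
  fin_cases i
  · show ε * ‖y 0‖ ^ 2 ≤ Q y
    nlinarith [sq_nonneg ‖y 1‖]
  · show ε * ‖y 1‖ ^ 2 ≤ Q y
    nlinarith [sq_nonneg ‖y 0‖]
  · show ε * ‖y 2‖ ^ 2 ≤ Q y
    have : ‖y 2‖ ^ 2 ≤ ‖y 0‖ ^ 2 + ‖y 1‖ ^ 2 := by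
      nlinarith [sq_nonneg ‖y 0‖, sq_nonneg ‖y 1‖]
    nlinarith

/-! ### Finiteness (Kudla–Millson Lemma 1.1, arithmetic core) -/

/-- **Bound at all embeddings.** For `w ∈ V` and a compact `K ⊆ 𝔹²` there is `B` such that every
`γ w` (`γ ∈ Γ`) whose special sub-ball meets `K` has `‖τ((γw)ᵢ)‖ ≤ B` at EVERY complex embedding `τ`
of `E` (at `τ₁` and its conjugate by `norm_sq_frame_le`; at the other places because `H^τ` is
definite and `⟪τ(γw), τ(γw)⟫_τ = τ⟪w, w⟫`). [cite: KudlaMillson1990, Lemma 1.1, p. 128] -/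
theorem exists_forall_norm_embedding_vact_le (w : Fin 3 → D.E) {K : Set Ball} (hK : IsCompact K) :
    ∃ B : ℝ, ∀ γ : D.Γ, (∃ z ∈ K, D.pairE (D.vact γ w) (D.coneLift 𝔣 z : Fin 3 → ℂ) = 0) →
      ∀ (τ : D.E →+* ℂ) (i : Fin 3), ‖τ (D.vact γ w i)‖ ≤ B := by
  obtain ⟨ε, hε, hKε⟩ := exists_nsq_le_of_isCompact hK
  -- the bound at `τ₁`
  set q : ℝ := Q (𝔣.ti *ᵥ (D.τ₁ ∘ w)) with hq
  set R₁ : ℝ := Real.sqrt (q / ε) with hR₁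
  have hτ₁ : ∀ γ : D.Γ, (∃ z ∈ K, D.pairE (D.vact γ w) (D.coneLift 𝔣 z : Fin 3 → ℂ) = 0) →
      ∀ i, ‖D.τ₁ (D.vact γ w i)‖ ≤ 3 * (𝔣.tBound * R₁) := by
    rintro γ ⟨z, hz, horth⟩ i
    have hy : ∀ j, ‖(𝔣.ti *ᵥ (D.τ₁ ∘ D.vact γ w)) j‖ ≤ R₁ := fun j ↦ by
      have h := D.norm_sq_frame_le 𝔣 hε (hKε z hz) horth j
      rw [Q_frame_vact] at h
      rw [hR₁]
      refine Real.le_sqrt_of_sq_le ?_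
      rw [le_div_iff₀ hε, mul_comm]
      exact h
    have heq : D.τ₁ ∘ D.vact γ w = 𝔣.t *ᵥ (𝔣.ti *ᵥ (D.τ₁ ∘ D.vact γ w)) := by
      rw [mulVec_mulVec, 𝔣.t_mul_ti, one_mulVec]
    have := norm_mulVec_apply_le 𝔣.norm_t_le hy i
    rw [← heq] at this
    exact this
  -- the bound at the definite places
  have hC : ∀ τ : D.E →+* ℂ, ∃ C : ℝ, InfinitePlace.mk τ ≠ InfinitePlace.mk D.τ₁ →
      ∀ γ : D.Γ, ∀ i, ‖τ (D.vact γ w i)‖ ≤ C := by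
    intro τ
    by_cases hτ : InfinitePlace.mk τ = InfinitePlace.mk D.τ₁
    · exact ⟨0, fun h ↦ (h hτ).elim⟩
    · obtain ⟨m, hm, hmle⟩ := exists_pos_mul_norm_sq_le_of_posDef (D.posDef_of_ne τ hτ)
      set c : ℝ := (star (τ ∘ w) ⬝ᵥ (D.H.map τ *ᵥ (τ ∘ w))).re
      refine ⟨Real.sqrt (c / m), fun _ γ i ↦ ?_⟩
      have h1 : m * ‖τ ∘ D.vact γ w‖ ^ 2 ≤ c := by
        have := hmle (τ ∘ D.vact γ w)
        rwa [D.re_form_embedding_vact τ γ w] at this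
      have h2 : ‖τ ∘ D.vact γ w‖ ^ 2 ≤ c / m := by
        rw [le_div_iff₀ hm, mul_comm]; exact h1
      calc ‖τ (D.vact γ w i)‖ = ‖(τ ∘ D.vact γ w) i‖ := rfl
        _ ≤ ‖τ ∘ D.vact γ w‖ := norm_le_pi_norm _ i
        _ = Real.sqrt (‖τ ∘ D.vact γ w‖ ^ 2) := (Real.sqrt_sq (norm_nonneg _)).symm
        _ ≤ Real.sqrt (c / m) := Real.sqrt_le_sqrt h2
  choose C hC using hC
  refine ⟨3 * (𝔣.tBound * R₁) + ∑ τ, |C τ|, fun γ hγ τ i ↦ ?_⟩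
  have h0 : 0 ≤ 3 * (𝔣.tBound * R₁) := (norm_nonneg _).trans (hτ₁ γ hγ 0)
  have hsum : 0 ≤ ∑ τ', |C τ'| := Finset.sum_nonneg fun _ _ ↦ abs_nonneg _
  by_cases hτ : InfinitePlace.mk τ = InfinitePlace.mk D.τ₁
  · rw [D.norm_embedding_eq_of_mk_eq hτ]
    exact (hτ₁ γ hγ i).trans (le_add_of_nonneg_right hsum)
  · calc ‖τ (D.vact γ w i)‖ ≤ C τ := hC τ hτ γ i
      _ ≤ |C τ| := le_abs_self _
      _ ≤ ∑ τ', |C τ'| :=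
          Finset.single_le_sum (f := fun τ' ↦ |C τ'|) (fun _ _ ↦ abs_nonneg _) (Finset.mem_univ τ)
      _ ≤ _ := le_add_of_nonneg_left h0

/-- **Kudla–Millson Lemma 1.1 (arithmetic core): finitely many orbit vectors meet a compact set.**
For `w ∈ V = E³` and a compact `K ⊆ 𝔹²`, the set of vectors `γ w` (`γ ∈ Γ`) whose special sub-ball
`𝔹((γw)^⊥)` meets `K` is finite (their multiples `d · γ w` are vectors of algebraic integers with all
conjugates bounded). [cite: KudlaMillson1990, Lemma 1.1, p. 128] [cite: Borel1969, Prop. 7.13] -/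
theorem finite_vact_meeting (w : Fin 3 → D.E) {K : Set Ball} (hK : IsCompact K) :
    {s : Fin 3 → D.E | (∃ γ : D.Γ, D.vact γ w = s) ∧
      ∃ z ∈ K, D.pairE s (D.coneLift 𝔣 z : Fin 3 → ℂ) = 0}.Finite := by
  obtain ⟨B, hB⟩ := D.exists_forall_norm_embedding_vact_le 𝔣 w hK
  obtain ⟨d, hd, hint⟩ := D.exists_int_isIntegral_vact w
  set T : Set D.E := {x : D.E | IsIntegral ℤ x ∧ ∀ φ : D.E →+* ℂ, ‖φ x‖ ≤ |(d : ℝ)| * B} with hT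
  have hTfin : T.Finite := Embeddings.finite_of_norm_le D.E ℂ (|(d : ℝ)| * B)
  haveI : Finite T := hTfin.to_subtype
  let F : (Fin 3 → T) → (Fin 3 → D.E) := fun f i ↦ (f i : D.E)
  have hrange : (Set.range F).Finite := Set.finite_range F
  -- `s ↦ d • s` is injective and lands in the range of `F`
  let M : (Fin 3 → D.E) → (Fin 3 → D.E) := fun s ↦ d • s
  have hMinj : Function.Injective M := smul_right_injective _ hd
  refine (hrange.preimage hMinj.injOn).subset ?_
  rintro s ⟨⟨γ, rfl⟩, hz⟩
  refine ⟨fun i ↦ ⟨d • D.vact γ w i, hint γ i, fun φ ↦ ?_⟩, ?_⟩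
  · rw [zsmul_eq_mul, map_mul, norm_mul, map_intCast, Complex.norm_intCast]
    exact mul_le_mul_of_nonneg_left (hB γ hz φ i) (abs_nonneg _)
  · funext i
    rfl

/-- **Local finiteness of the translates of a special sub-ball.** For a finite set `S ⊆ V = E³` and
a compact `K ⊆ 𝔹²`, only finitely many translates `γ S` (`γ ∈ Γ`) have special sub-ball
`𝔹((γS)^⊥)` meeting `K` (each `γ s`, `s ∈ S`, ranges in the finite set of `finite_vact_meeting`).
[cite: KudlaMillson1990, Lemma 1.1, p. 128] -/
theorem finite_translates_specialBall {S : Set (Fin 3 → D.E)} (hS : S.Finite) {K : Set Ball}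
    (hK : IsCompact K) :
    {S' : Set (Fin 3 → D.E) | (∃ γ : D.Γ, D.vact γ '' S = S') ∧
      (D.specialBall 𝔣 S' ∩ K).Nonempty}.Finite := by
  -- the finite set of all orbit vectors of elements of `S` meeting `K`
  set F : Set (Fin 3 → D.E) := ⋃ w ∈ S, {s : Fin 3 → D.E | (∃ γ : D.Γ, D.vact γ w = s) ∧
      ∃ z ∈ K, D.pairE s (D.coneLift 𝔣 z : Fin 3 → ℂ) = 0}
  have hF : F.Finite := hS.biUnion fun w _ ↦ D.finite_vact_meeting 𝔣 w hK
  -- every translate meeting `K` is a subset of `F`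
  refine (hF.finite_subsets).subset ?_
  rintro S' ⟨⟨γ, rfl⟩, ⟨z, hzS, hzK⟩⟩
  rintro _ ⟨w, hw, rfl⟩
  refine Set.mem_biUnion hw ⟨⟨γ, rfl⟩, z, hzK, ?_⟩
  exact hzS _ ⟨w, hw, rfl⟩

/-- **Local finiteness, submodule form.** For an `E`-subspace `W ⊆ V = E³` and a compact `K ⊆ 𝔹²`,
only finitely many of the special sub-balls `𝔹((γW)^⊥)`, `γ ∈ Γ`, meet `K`.
[cite: KudlaMillson1990, Lemma 1.1, p. 128] [cite: BergeronMillsonMoeglin2016Balls, Introduction §1.7] -/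
theorem finite_specialBall_translates_submodule (W : Submodule D.E (Fin 3 → D.E)) {K : Set Ball}
    (hK : IsCompact K) :
    {B : Set Ball | (∃ γ : D.Γ, D.specialBall 𝔣 (D.vact γ '' (W : Set (Fin 3 → D.E))) = B) ∧
      (B ∩ K).Nonempty}.Finite := by
  classical
  -- a finite spanning set of `W`
  obtain ⟨S₀, hspan⟩ : ∃ S₀ : Finset (Fin 3 → D.E),
      Submodule.span D.E (S₀ : Set (Fin 3 → D.E)) = W :=
    (inferInstance : IsNoetherian D.E (Fin 3 → D.E)).noetherian W
  -- the translate of `W` is the span of the translate of `S₀` (`γ` acts linearly)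
  have hlin : ∀ (γ : D.Γ) (S : Set (Fin 3 → D.E)), D.vact γ '' S =
      Matrix.mulVecLin ((γ : GL (Fin 3) D.E) : Matrix (Fin 3) (Fin 3) D.E) '' S := fun _ _ ↦ rfl
  have htrans : ∀ γ : D.Γ, D.specialBall 𝔣 (D.vact γ '' (W : Set (Fin 3 → D.E))) =
      D.specialBall 𝔣 (D.vact γ '' (S₀ : Set (Fin 3 → D.E))) := by
    intro γ
    have hsp : Submodule.span D.E (D.vact γ '' (S₀ : Set (Fin 3 → D.E))) =
        Submodule.span D.E (D.vact γ '' (W : Set (Fin 3 → D.E))) := by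
      rw [hlin, hlin, Submodule.span_image, Submodule.span_image, hspan, Submodule.span_eq]
    rw [← D.specialBall_span 𝔣 (D.vact γ '' (W : Set (Fin 3 → D.E))), ← hsp, D.specialBall_span]
  have hfin := D.finite_translates_specialBall 𝔣 S₀.finite_toSet hK
  refine (hfin.image fun S' ↦ D.specialBall 𝔣 S').subset ?_
  rintro B ⟨⟨γ, rfl⟩, hBK⟩
  refine ⟨D.vact γ '' (S₀ : Set (Fin 3 → D.E)), ⟨⟨γ, rfl⟩, ?_⟩, (htrans γ).symm⟩
  rwa [← htrans γ]

end UnitaryBallUniformisationDatum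

end Literature.AlgebraicGeometry.ShimuraVarieties

end
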